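import Literature.Analysis.FluidPDE.ClassicalSuitable
import Literature.Analysis.FluidPDE.ClassicalSolutionCalculus
import Literature.Analysis.FluidPDE.WeakGradientIBP
import HarnessLib

/-!
# The local energy inequality with boundary terms for classical solutions of the Navier–Stokes inequality

Analysis/FluidPDE support file (serves the discharge of the barrier fact
`Literature.Barriers.NavierStokesRegularity.NSISwitching`: Scheffer 1985, Lemma 2.3 /
Ożański 2017, §2). It renders the printed step

> "the NSI can be rewritten, for smooth `u` and `p`, in the form
> `½∂ₜ|u|² − (ν/2)Δ|u|² + ν|∇u|² + u·∇(½|u|² + p) ≤ 0` …; multiplication by `2φ` and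
> integration by parts gives the local energy inequality"

(Ożański 2017, §1, after Def. 2) in the **time-localised form with boundary terms** which is
the one used to combine solutions "one after another" (Ożański 2017, (1.5); Scheffer 1985, the
admissibility condition of §2, p. 50, obtained at the end of the proof of Lemma 2.1, p. 55:
"Multiplying (2.18) and (2.27) by `φ(x,t)`, integrating over `ℝ³ × [a,b]`, and applying
integration by parts"):

for a velocity field `u` jointly `C^∞` on an open time set `S ⊇ [a, b]` with slices supported in
a fixed compact set `K` and divergence free on `[a,b]`, a pressure `p` with `C¹` slices, jointly
continuous on `[a,b] × E`, satisfying the **pointwise Navier–Stokes inequality**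
`∂ₜ|u|² ≤ −u·∇(|u|² + 2p) + 2ν u·Δu` on `[a,b] × E`, and every nonnegative space–time test
function `φ`,

  `∫ |u(b)|² φ(b) − ∫ |u(a)|² φ(a) + 2ν ∫ₐᵇ∫ |∇u|² φ
      ≤ ∫ₐᵇ∫ ( |u|² (∂ₜφ + νΔφ) + (|u|² + 2p) u·∇φ )`                (`nsi_localEnergyIneq_Icc`).

## Proof

At a fixed time define the force `f := ∂ₜu + (u·∇)u − νΔu + ∇p`; the pointwise NSI says
exactly `f·u ≤ 0` (`inner_force_self_nonpos_of_nsi`), and the slice balance of the accepted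
`ClassicalSuitable` (`integral_energy_flux_eq_of_momentum`, the momentum equation being an
identity by the choice of `f`) gives
`∫ ∂ₜ(|u|²φ) + 2ν ∫ |∇u|²φ ≤ ∫ (|u|²(∂ₜφ + νΔφ) + (|u|² + 2p) u·∇φ)` on each slice
(`nsi_slice_ineq`); the boundary terms come from the fundamental theorem of calculus on each
time line and Fubini on `(a,b) × E` (as in the tree's `local_energy_identity_smooth`).

## Mathlib / tree search

Tree: `integral_energy_flux_eq_of_momentum`, `continuousOn_timeDeriv_of_contDiffOn`
(`ClassicalSuitable`); `integrable_prod_of_continuousOn`, `IsSpaceTimeTestOn.*`,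
`IsSmoothSpaceTimeOn.laplacian` (`ClassicalSolutionCalculus`); `hasDerivAt_timeLine_of_contDiffOn`,
`contDiff_slice_of_contDiffOn`, `continuousOn_fderiv_slice_of_contDiffOn` (`SpaceTimeCalculusC1`).
Mathlib: `intervalIntegral.integral_eq_sub_of_hasDerivAt`, `integral_integral_swap`,
`setIntegral_mono_on`, `HasDerivAt.norm_sq`, `HasFDerivAt.norm_sq` (all used).

## References

* W. S. Ożański, *On weak solutions to the Navier–Stokes inequality with internal
  singularities*, arXiv:1709.00602 (2017), §1: Def. 2, the NSI (1.3)–(1.4) and the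
  alternative local energy inequality (1.5). [`Ozanski2017NSISingular`]
* V. Scheffer, *A solution to the Navier–Stokes inequality with an internal singularity*,
  Comm. Math. Phys. 101 (1985), §2 (admissible 5-tuples, p. 50) and the end of the proof of
  Lemma 2.1 (p. 55). [`Scheffer1985`]
* L. Caffarelli, R. Kohn, L. Nirenberg, Comm. Pure Appl. Math. 35 (1982), §2 (2.5).
  [`CaffarelliKohnNirenberg1982`]
-/

noncomputable section

open MeasureTheory TopologicalSpace Set Function Filter Topology Metric
open scoped Laplacian InnerProductSpace RealInnerProductSpace ENNReal NNReal ContDiff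

namespace Literature.Analysis.FluidPDE

variable {E : Type*} [NormedAddCommGroup E] [InnerProductSpace ℝ E] [FiniteDimensional ℝ E]
  [MeasurableSpace E] [BorelSpace E]

/-! ### The pointwise Navier–Stokes inequality says `f·u ≤ 0` -/

section Pointwise

variable {ν : ℝ} {u dtu : E → E} {p : E → ℝ} {N : E → ℝ}

omit [MeasurableSpace E] [BorelSpace E] in
/-- `u·∇(|u|² + 2p) = 2⟪Du(u), u⟫ + 2⟪∇p, u⟫` for `u, p ∈ C¹`. [folklore] -/
theorem inner_gradient_norm_sq_add_two_mul (hu : ContDiff ℝ 1 u) (hp : ContDiff ℝ 1 p) (x : E) :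
    ⟪u x, gradient (fun y => ‖u y‖ ^ 2 + 2 * p y) x⟫ =
      2 * ⟪fderiv ℝ u x (u x), u x⟫ + 2 * ⟪gradient p x, u x⟫ := by
  haveI : CompleteSpace E := FiniteDimensional.complete ℝ E
  have hud : DifferentiableAt ℝ u x := hu.differentiable one_ne_zero x
  have hpd : DifferentiableAt ℝ p x := hp.differentiable one_ne_zero x
  have hNd : DifferentiableAt ℝ (fun y => ‖u y‖ ^ 2) x := hud.norm_sq ℝ
  have h2pd : DifferentiableAt ℝ (fun y => 2 * p y) x := hpd.const_mul 2
  have h1 : fderiv ℝ (fun y => ‖u y‖ ^ 2) x (u x) = 2 * ⟪u x, fderiv ℝ u x (u x)⟫ := by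
    rw [(hud.hasFDerivAt.norm_sq).fderiv]
    simp [innerSL_apply_apply, two_smul]
    ring
  rw [inner_gradient_eq_fderiv_apply, fderiv_fun_add hNd h2pd, fderiv_const_mul hpd,
    real_inner_comm (u x) (gradient p x), inner_gradient_eq_fderiv_apply]
  change fderiv ℝ (fun y => ‖u y‖ ^ 2) x (u x) + (2 : ℝ) • fderiv ℝ p x (u x) = _
  rw [h1, real_inner_comm (fderiv ℝ u x (u x)) (u x), smul_eq_mul]

omit [MeasurableSpace E] [BorelSpace E] in
/-- **The pointwise Navier–Stokes inequality is `f·u ≤ 0`.** If `N = ∂ₜ|u|² = 2⟪u, ∂ₜu⟫`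
satisfies `N ≤ −u·∇(|u|² + 2p) + 2ν u·Δu` at `x`, then the force
`f = ∂ₜu + (u·∇)u − νΔu + ∇p` acts against the flow at `x`: `⟪f, u⟫ ≤ 0`
(Ożański 2017, §1, (1.3)–(1.4); Scheffer 1985, (1.10)–(1.12)).
[cite: Ozanski2017NSISingular, §1 (1.3)–(1.4)] -/
theorem inner_force_self_nonpos_of_nsi (hu : ContDiff ℝ 1 u) (hp : ContDiff ℝ 1 p) {x : E}
    (hN : N x = 2 * ⟪u x, dtu x⟫)
    (hnsi : N x ≤ -⟪u x, gradient (fun y => ‖u y‖ ^ 2 + 2 * p y) x⟫ + 2 * ν * ⟪u x, Δ u x⟫) :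
    ⟪dtu x + convect u u x - ν • Δ u x + gradient p x, u x⟫ ≤ 0 := by
  rw [inner_gradient_norm_sq_add_two_mul hu hp x, hN] at hnsi
  rw [inner_add_left, inner_sub_left, inner_add_left, inner_smul_left, convect_apply,
    real_inner_comm (u x) (dtu x)]
  simp only [RCLike.conj_to_real]
  rw [real_inner_comm (u x) (Δ u x)]
  linarith

end Pointwise

/-! ### The slice inequality -/

section Slice

variable {ν : ℝ} {u dtu : E → E} {p : E → ℝ} {N : E → ℝ}

/-- **The local energy balance of a classical NSI solution at a fixed time.** Let `u ∈ C²(E;E)`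
be divergence free with compact support, `p ∈ C¹`, `dtu` continuous (the time derivative of
the ambient field) and `N = 2⟪u, dtu⟫` (`= ∂ₜ|u|²`) with
`N ≤ −u·∇(|u|² + 2p) + 2ν u·Δu` pointwise. Then for every nonnegative `φ ∈ C²_c` and every
continuous `dφ` (the time derivative of the ambient test function)
`∫ (dφ |u|² + φ N) + 2ν ∫ |∇u|² φ ≤ ∫ ( |u|²(dφ + νΔφ) + (|u|² + 2p) u·∇φ )`: the slice
balance `integral_energy_flux_eq_of_momentum` for the force `f = ∂ₜu + (u·∇)u − νΔu + ∇p`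
together with `f·u ≤ 0` (Ożański 2017, §1: "multiplication by `2φ` and integration by parts").
[cite: Ozanski2017NSISingular, §1 (1.4)–(1.5)] -/
theorem nsi_slice_ineq (hu : ContDiff ℝ 2 u) (huc : HasCompactSupport u) (hp : ContDiff ℝ 1 p)
    (hdt : Continuous dtu) (hdiv : VectorCalculus.IsDivFree u)
    (hN : ∀ x, N x = 2 * ⟪u x, dtu x⟫)
    (hnsi : ∀ x, N x ≤ -⟪u x, gradient (fun y => ‖u y‖ ^ 2 + 2 * p y) x⟫ + 2 * ν * ⟪u x, Δ u x⟫)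
    {φ dφ : E → ℝ} (hφ : ContDiff ℝ 2 φ) (hφc : HasCompactSupport φ) (hφ0 : ∀ x, 0 ≤ φ x)
    (hdφ : Continuous dφ) :
    (∫ x, (dφ x * ‖u x‖ ^ 2 + φ x * N x)) +
        2 * ν * ∫ x, frobeniusNormSq (fderiv ℝ u x) * φ x ≤
      ∫ x, (‖u x‖ ^ 2 * (dφ x + ν * Δ φ x) + (‖u x‖ ^ 2 + 2 * p x) * ⟪u x, gradient φ x⟫) := by
  haveI : CompleteSpace E := FiniteDimensional.complete ℝ E
  have hu1 : ContDiff ℝ 1 u := hu.of_le one_le_two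
  have huc' : Continuous u := hu1.continuous
  -- the force
  set f : E → E := fun x => dtu x + convect u u x - ν • Δ u x + gradient p x with hf_def
  have hfc : Continuous f := by
    refine ((hdt.add ?_).sub (continuous_const.smul (continuous_laplacian hu))).add
      (continuous_gradient_of_contDiff hp)
    exact (hu1.continuous_fderiv one_ne_zero).clm_apply huc'
  have hmom : ∀ x, dtu x + convect u u x = ν • (Δ u) x - gradient p x + f x := fun x => by
    simp only [hf_def]; abel
  have hfu : ∀ x, ⟪f x, u x⟫ ≤ 0 := fun x =>
    inner_force_self_nonpos_of_nsi hu1 hp (hN x) (hnsi x)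
  -- the slice balance of `ClassicalSuitable`
  have key := integral_energy_flux_eq_of_momentum hu hp hdt hfc hmom hdiv hφ hφc
  -- integrability of the pieces
  have hφc' : Continuous φ := hφ.continuous
  have hDφ : Continuous (fderiv ℝ φ) := (hφ.of_le one_le_two).continuous_fderiv one_ne_zero
  have hu0 : ∀ x ∉ tsupport u, u x = 0 := fun x hx => image_eq_zero_of_notMem_tsupport hx
  have csu : ∀ {g : E → ℝ}, Continuous g →
      Integrable (fun x => g x * ‖u x‖ ^ 2) (volume : Measure E) :=
    fun hg => (hg.mul (huc'.norm.pow 2)).integrable_of_hasCompactSupport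
      (HasCompactSupport.intro huc fun x hx => by simp [hu0 x hx])
  have i1 : Integrable (fun x => ν * ((Δ φ) x * ‖u x‖ ^ 2) + fderiv ℝ φ x (u x) * ‖u x‖ ^ 2 +
      2 * (p x * fderiv ℝ φ x (u x))) (volume : Measure E) := by
    refine (((csu (continuous_laplacian hφ)).const_mul ν).add (csu (hDφ.clm_apply huc'))).add ?_
    refine ((hp.continuous.mul (hDφ.clm_apply huc')).integrable_of_hasCompactSupport ?_).const_mul 2
    exact HasCompactSupport.intro huc fun x hx => by simp [hu0 x hx]
  have i2 : Integrable (fun x => 2 * (φ x * ⟪f x, u x⟫)) (volume : Measure E) :=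
    ((hφc'.mul (hfc.inner huc')).integrable_of_hasCompactSupport
      (HasCompactSupport.intro huc fun x hx => by simp [hu0 x hx])).const_mul 2
  have i3 : Integrable (fun x => dφ x * ‖u x‖ ^ 2) (volume : Measure E) := csu hdφ
  have i4 : Integrable (fun x => φ x * N x) (volume : Measure E) := by
    have : (fun x => φ x * N x) = fun x => φ x * (2 * ⟪u x, dtu x⟫) := funext fun x => by rw [hN x]
    rw [this]
    exact (hφc'.mul (continuous_const.mul (huc'.inner hdt))).integrable_of_hasCompactSupport
      hφc.mul_right
  -- the force term is nonpositive
  have hneg : ∫ x, 2 * (φ x * ⟪f x, u x⟫) ≤ 0 :=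
    integral_nonpos fun x => mul_nonpos_of_nonneg_of_nonpos zero_le_two
      (mul_nonpos_of_nonneg_of_nonpos (hφ0 x) (hfu x))
  -- split the left-hand side of the slice balance
  rw [integral_add i1 i2] at key
  have eN : ∫ x, φ x * (2 * ⟪u x, dtu x⟫) = ∫ x, φ x * N x :=
    integral_congr_ae (Eventually.of_forall fun x => by simp only [hN x])
  rw [eN] at key
  -- the right-hand side of the claim
  have eR : ∫ x, (‖u x‖ ^ 2 * (dφ x + ν * Δ φ x) + (‖u x‖ ^ 2 + 2 * p x) * ⟪u x, gradient φ x⟫) =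
      (∫ x, dφ x * ‖u x‖ ^ 2) + ∫ x, (ν * ((Δ φ) x * ‖u x‖ ^ 2) +
        fderiv ℝ φ x (u x) * ‖u x‖ ^ 2 + 2 * (p x * fderiv ℝ φ x (u x))) := by
    rw [← integral_add i3 i1]
    refine integral_congr_ae (Eventually.of_forall fun x => ?_)
    simp only [inner_gradient_eq_fderiv_apply]
    ring
  rw [eR, integral_add i3 i4]
  linarith

end Slice

/-! ### The space–time inequality with boundary terms -/

section SpaceTime

variable {S : Set ℝ} {a b ν : ℝ} {u : ℝ → E → E} {p : ℝ → E → ℝ} {K : Set E}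
  {φ : ℝ → E → ℝ}

omit [MeasurableSpace E] [BorelSpace E] [InnerProductSpace ℝ E] [FiniteDimensional ℝ E] in
/-- The topological support of a slice of a field vanishing off a closed set `K` lies in `K`. [folklore] -/
theorem tsupport_slice_subset_of_eq_zero [NormedSpace ℝ E] {K : Set E} (hK : IsClosed K) {v : E → E}
    (h0 : ∀ x ∉ K, v x = 0) : tsupport v ⊆ K :=
  closure_minimal (fun x hx => by by_contra h; exact hx (h0 x h)) hK

/-- **The local energy inequality with boundary terms for classical solutions of the
Navier–Stokes inequality** (Ożański 2017, (1.5); Scheffer 1985, §2, admissibility condition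
(p. 50) via the end of the proof of Lemma 2.1 (p. 55)). Let `S ⊆ ℝ` be open with `[a,b] ⊆ S`,
`u` jointly `C^∞` on `S × E` with `u(t, x) = 0` for `x ∉ K` (`K` compact) and `div u(t) = 0`
for `t ∈ [a,b]`; let `p` have `C¹` slices and be jointly continuous on `[a,b] × E`; assume the
pointwise Navier–Stokes inequality `∂ₜ|u|² ≤ −u·∇(|u|² + 2p) + 2ν u·Δu` on `[a,b] × E`. Then
for every nonnegative space–time test function `φ`,
`∫ |u(b)|²φ(b) − ∫ |u(a)|²φ(a) + 2ν ∫ₐᵇ∫ |∇u|²φ ≤ ∫ₐᵇ∫ (|u|²(∂ₜφ + νΔφ) + (|u|² + 2p) u·∇φ)`.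
[cite: Ozanski2017NSISingular, §1 (1.5)] [cite: Scheffer1985, §2 p. 50 and proof of Lemma 2.1 p. 55] -/
theorem nsi_localEnergyIneq_Icc (hab : a ≤ b) (hS : IsOpen S) (hIS : Icc a b ⊆ S)
    (hu : ContDiffOn ℝ ∞ (uncurry u) (S ×ˢ univ)) (hK : IsCompact K)
    (h0 : ∀ t ∈ Icc a b, ∀ x ∉ K, u t x = 0)
    (hdiv : ∀ t ∈ Icc a b, VectorCalculus.IsDivFree (u t))
    (hp : ∀ t ∈ Icc a b, ContDiff ℝ 1 (p t)) (hpc : ContinuousOn (uncurry p) (Icc a b ×ˢ univ))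
    (hnsi : ∀ t ∈ Icc a b, ∀ x, timeDeriv (fun s y => ‖u s y‖ ^ 2) t x ≤
      -⟪u t x, gradient (fun y => ‖u t y‖ ^ 2 + 2 * p t y) x⟫ + 2 * ν * ⟪u t x, Δ (u t) x⟫)
    (hφ : IsSpaceTimeTestOn (⊤ : Opens (ℝ × E)) φ) (hφ0 : ∀ t x, 0 ≤ φ t x) :
    (∫ x, ‖u b x‖ ^ 2 * φ b x) - (∫ x, ‖u a x‖ ^ 2 * φ a x) +
        2 * ν * ∫ t in Ioo a b, ∫ x, frobeniusNormSq (fderiv ℝ (u t) x) * φ t x ≤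
      ∫ t in Ioo a b, ∫ x, (‖u t x‖ ^ 2 * (timeDeriv φ t x + ν * Δ (φ t) x) +
        (‖u t x‖ ^ 2 + 2 * p t x) * ⟪u t x, gradient (φ t) x⟫) := by
  haveI : CompleteSpace E := FiniteDimensional.complete ℝ E
  have hSu : UniqueDiffOn ℝ S := hS.uniqueDiffOn
  have hsm : IsSmoothSpaceTimeOn S u := hu
  have hu1 : ContDiffOn ℝ 1 (uncurry u) (S ×ˢ univ) := hu.of_le (by
    change ((1 : ℕ∞) : WithTop ℕ∞) ≤ ((⊤ : ℕ∞) : WithTop ℕ∞); exact_mod_cast le_top)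
  -- joint continuity on `S × E` of the fields entering the integrands
  have cu : ContinuousOn (fun z : ℝ × E => u z.1 z.2) (S ×ˢ univ) := hu.continuousOn
  have cdt : ContinuousOn (fun z : ℝ × E => timeDeriv u z.1 z.2) (S ×ˢ univ) :=
    continuousOn_timeDeriv_of_contDiffOn hS hu1
  have cDu : ContinuousOn (fun z : ℝ × E => fderiv ℝ (u z.1) z.2) (S ×ˢ univ) :=
    continuousOn_fderiv_slice_of_contDiffOn hu1 hSu
  have cφ : Continuous fun z : ℝ × E => φ z.1 z.2 := hφ.contDiff.continuous
  have cTφ : Continuous fun z : ℝ × E => timeDeriv φ z.1 z.2 := hφ.continuous_timeDeriv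
  have cgφ : Continuous fun z : ℝ × E => gradient (φ z.1) z.2 := hφ.continuous_slice_gradient
  have cΔφ : Continuous fun z : ℝ × E => (Δ (φ z.1)) z.2 := hφ.continuous_laplacian_slice
  -- restriction to `[a,b] × E`
  have hIsub : Icc a b ×ˢ (univ : Set E) ⊆ S ×ˢ univ := prod_mono hIS Subset.rfl
  have cu' := cu.mono hIsub
  have cdt' := cdt.mono hIsub
  have cDu' := cDu.mono hIsub
  -- the time derivative of `|u|²` is `2⟪u, ∂ₜu⟫` on `S`
  have hN : ∀ t ∈ S, ∀ x, timeDeriv (fun s y => ‖u s y‖ ^ 2) t x = 2 * ⟪u t x, timeDeriv u t x⟫ := by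
    intro t ht x
    have hd := hasDerivAt_timeLine_of_contDiffOn hu1 (hS.mem_nhds ht) x
    rw [timeDeriv_apply, hd.norm_sq.deriv, show timeDeriv u t x = fderiv ℝ (uncurry u) (t, x) (1, 0)
      from hd.deriv]
  -- vanishing off `K`
  have hKc : IsClosed K := hK.isClosed
  have hts : ∀ t ∈ Icc a b, tsupport (u t) ⊆ K := fun t ht =>
    tsupport_slice_subset_of_eq_zero hKc (h0 t ht)
  have hDu0 : ∀ t ∈ Icc a b, ∀ x ∉ K, fderiv ℝ (u t) x = 0 := fun t ht x hx =>
    fderiv_of_notMem_tsupport ℝ fun h => hx (hts t ht h)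
  -- the integrands `D = ∂ₜ(φ|u|²)`, `G = |∇u|²φ`, `R`
  set D : ℝ × E → ℝ := fun z => timeDeriv φ z.1 z.2 * ‖u z.1 z.2‖ ^ 2 +
    φ z.1 z.2 * (2 * ⟪u z.1 z.2, timeDeriv u z.1 z.2⟫) with hD
  set G : ℝ × E → ℝ := fun z => frobeniusNormSq (fderiv ℝ (u z.1) z.2) * φ z.1 z.2 with hG
  set R : ℝ × E → ℝ := fun z => ‖u z.1 z.2‖ ^ 2 * (timeDeriv φ z.1 z.2 + ν * (Δ (φ z.1)) z.2) +
    (‖u z.1 z.2‖ ^ 2 + 2 * p z.1 z.2) * ⟪u z.1 z.2, gradient (φ z.1) z.2⟫ with hR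
  have cD : ContinuousOn D (Icc a b ×ˢ univ) :=
    (cTφ.continuousOn.mul (cu'.norm.pow 2)).add
      (cφ.continuousOn.mul (continuousOn_const.mul (cu'.inner cdt')))
  have cG : ContinuousOn G (Icc a b ×ˢ univ) :=
    (LerayHopfProofs.continuous_frobeniusNormSq.comp_continuousOn cDu').mul cφ.continuousOn
  have cR : ContinuousOn R (Icc a b ×ˢ univ) :=
    ((cu'.norm.pow 2).mul (cTφ.continuousOn.add (continuousOn_const.mul cΔφ.continuousOn))).add
      (((cu'.norm.pow 2).add (continuousOn_const.mul hpc)).mul (cu'.inner cgφ.continuousOn))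
  have D0 : ∀ t ∈ Icc a b, ∀ x ∉ K, D (t, x) = 0 := fun t ht x hx => by
    simp only [hD, h0 t ht x hx, norm_zero, inner_zero_left]; ring
  have G0 : ∀ t ∈ Icc a b, ∀ x ∉ K, G (t, x) = 0 := fun t ht x hx => by
    simp only [hG, hDu0 t ht x hx, frobeniusNormSq_zero, zero_mul]
  have R0 : ∀ t ∈ Icc a b, ∀ x ∉ K, R (t, x) = 0 := fun t ht x hx => by
    simp only [hR, h0 t ht x hx, norm_zero, inner_zero_left]; ring
  have hDint := integrable_prod_of_continuousOn (a := a) (b := b) hK cD D0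
  have hGint := integrable_prod_of_continuousOn (a := a) (b := b) hK cG G0
  have hRint := integrable_prod_of_continuousOn (a := a) (b := b) hK cR R0
  -- slice-wise integrability (continuous with support in `K`)
  have islice : ∀ {T : ℝ × E → ℝ}, ContinuousOn T (Icc a b ×ˢ univ) →
      (∀ t ∈ Icc a b, ∀ x ∉ K, T (t, x) = 0) → ∀ t ∈ Icc a b,
      Integrable (fun x => T (t, x)) (volume : Measure E) := by
    intro T hc hT0 t ht
    have hct : Continuous fun x => T (t, x) :=
      hc.comp_continuous (Continuous.prodMk_right t) fun x => ⟨ht, mem_univ x⟩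
    exact hct.integrable_of_hasCompactSupport (HasCompactSupport.intro hK fun x hx => hT0 t ht x hx)
  -- Step A: the time derivative of `φ|u|²` on `S`
  have hderiv : ∀ s ∈ S, ∀ x, HasDerivAt (fun σ => ‖u σ x‖ ^ 2 * φ σ x) (D (s, x)) s := by
    intro s hs x
    have hd := hasDerivAt_timeLine_of_contDiffOn hu1 (hS.mem_nhds hs) x
    have h1 := hd.norm_sq.mul (hφ.hasDerivAt_time s x)
    refine h1.congr_deriv ?_
    simp only [hD]
    rw [show timeDeriv u s x = fderiv ℝ (uncurry u) (s, x) (1, 0) from hd.deriv]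
    ring
  -- Step B: fundamental theorem of calculus on each time line
  have hline : ∀ x, ∫ s in Ioo a b, D (s, x) = ‖u b x‖ ^ 2 * φ b x - ‖u a x‖ ^ 2 * φ a x := by
    intro x
    have hcont : ContinuousOn (fun s => D (s, x)) (Icc a b) :=
      cD.comp (continuous_id.prodMk continuous_const).continuousOn
        fun s hs => ⟨hs, mem_univ x⟩
    have hint : IntervalIntegrable (fun s => D (s, x)) volume a b :=
      (hcont.mono (by rw [uIcc_of_le hab])).intervalIntegrable
    have hd' : ∀ s ∈ uIcc a b, HasDerivAt (fun σ => ‖u σ x‖ ^ 2 * φ σ x) (D (s, x)) s := by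
      intro s hs
      rw [uIcc_of_le hab] at hs
      exact hderiv s (hIS hs) x
    have := intervalIntegral.integral_eq_sub_of_hasDerivAt hd' hint
    rwa [intervalIntegral.integral_of_le hab, integral_Ioc_eq_integral_Ioo] at this
  -- Step C: Fubini for `D`
  have stepC : (∫ x, ‖u b x‖ ^ 2 * φ b x) - (∫ x, ‖u a x‖ ^ 2 * φ a x) =
      ∫ s in Ioo a b, ∫ x, D (s, x) := by
    have hb : b ∈ Icc a b := right_mem_Icc.2 hab
    have ha : a ∈ Icc a b := left_mem_Icc.2 hab
    have ib : Integrable (fun x => ‖u b x‖ ^ 2 * φ b x) (volume : Measure E) :=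
      ((cu'.comp_continuous (Continuous.prodMk_right b) fun x => ⟨hb, mem_univ x⟩).norm.pow 2 |>.mul
        (cφ.comp (Continuous.prodMk_right b))).integrable_of_hasCompactSupport
        (HasCompactSupport.intro hK fun x hx => by simp [h0 b hb x hx])
    have ia : Integrable (fun x => ‖u a x‖ ^ 2 * φ a x) (volume : Measure E) :=
      ((cu'.comp_continuous (Continuous.prodMk_right a) fun x => ⟨ha, mem_univ x⟩).norm.pow 2 |>.mul
        (cφ.comp (Continuous.prodMk_right a))).integrable_of_hasCompactSupport
        (HasCompactSupport.intro hK fun x hx => by simp [h0 a ha x hx])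
    rw [← integral_sub ib ia]
    simp_rw [← hline]
    exact (integral_integral_swap (f := fun s x => D (s, x)) hDint).symm
  -- Step D: the slice inequality at each `s ∈ [a,b]`
  have hslice : ∀ s ∈ Icc a b, (∫ x, D (s, x)) + 2 * ν * (∫ x, G (s, x)) ≤ ∫ x, R (s, x) := by
    intro s hs
    have hsS : s ∈ S := hIS hs
    have hu2s : ContDiff ℝ 2 (u s) := contDiff_infty.1 (hsm.contDiff_slice hsS) 2
    have hucs : HasCompactSupport (u s) := hK.of_isClosed_subset (isClosed_tsupport _) (hts s hs)
    have hdts : Continuous (timeDeriv u s) :=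
      cdt.comp_continuous (Continuous.prodMk_right s) fun x => ⟨hsS, mem_univ x⟩
    have hφ2 : ContDiff ℝ 2 (φ s) := contDiff_infty.1 (hφ.contDiff_slice s) 2
    have hφcs : HasCompactSupport (φ s) := hφ.hasCompactSupport_slice s
    have hdφs : Continuous (timeDeriv φ s) := cTφ.comp (Continuous.prodMk_right s)
    have key := nsi_slice_ineq (ν := ν) (N := fun x => timeDeriv (fun σ y => ‖u σ y‖ ^ 2) s x)
      hu2s hucs (hp s hs) hdts (hdiv s hs) (fun x => hN s hsS x) (hnsi s hs) hφ2 hφcs (hφ0 s) hdφs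
    have eD : ∫ x, D (s, x) = ∫ x, (timeDeriv φ s x * ‖u s x‖ ^ 2 +
        φ s x * timeDeriv (fun σ y => ‖u σ y‖ ^ 2) s x) :=
      integral_congr_ae (Eventually.of_forall fun x => by simp only [hD, hN s hsS x])
    rw [eD]
    exact key
  -- Step E: integrate the slice inequality in time
  have hDl : Integrable (fun s => ∫ x, D (s, x)) (volume.restrict (Ioo a b)) := hDint.integral_prod_left
  have hGl : Integrable (fun s => ∫ x, G (s, x)) (volume.restrict (Ioo a b)) := hGint.integral_prod_left
  have hRl : Integrable (fun s => ∫ x, R (s, x)) (volume.restrict (Ioo a b)) := hRint.integral_prod_left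
  have stepE : ∫ s in Ioo a b, ((∫ x, D (s, x)) + 2 * ν * ∫ x, G (s, x)) ≤
      ∫ s in Ioo a b, ∫ x, R (s, x) :=
    setIntegral_mono_on (hDl.add (hGl.const_mul _)) hRl measurableSet_Ioo
      fun s hs => hslice s (Ioo_subset_Icc_self hs)
  rw [integral_add hDl (hGl.const_mul _), integral_const_mul, ← stepC] at stepE
  exact stepE

end SpaceTime

end Literature.Analysis.FluidPDE

end
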